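import Summits.CriticalPhenomena.PercolationContinuityZ3.Theorems.PercNearOneGluingNoHeavyLowerTailSahiGridPatternPairCert

/-!
# `NoHeavyLowerTail` (crux stmt-CriticalPhenomena-4575), Sahi programme P1: **THE RECURSIVE (ORTHANT-ABSORPTION) CERTIFICATE** —
# nonnegativity and condition (T) in every dimension, and the reduction of condition (N) to ONE c-free core inequality

Support file (Sahi cell, seat `prim-sahi-p1`, generation 23; `--supports stmt-CriticalPhenomena-4575`).  Pure proofs, no definitions,
no `sorry`, standard axioms.  Vocabulary of `…SahiGridPattern{CellForm,DiagCert,PairCert}` (`glue`, `freeOf`, `cellOf`, `fibre`, `sect`,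
`nuCount`, `lamU`, `thetaVal`, `sStarD`).

THE MATHEMATICS.  Work on `[3]^{n+k} = [3]^n × [3]^k` (`glue ξ q`).  Let `X ⊆ [3]^{n+k}` be free-block-measurable with trace `X_I ⊆ [3]^n`
(the PAYER; for the star theorem `X_I = ↑a` is an orthant) and `Y` cell-block-measurable with trace `V ⊆ [3]^k` (the INNER set), `U = X ∪ Y`.
Suppose `V` carries a vector `c : [3]^k → ℤ` (in the application a diagonal certificate of `V`: `c ≥ 0`, (T') `Σ_W c ≤ Σ_W λ_V`,
(N') `Θ_V(P×Q) ≤ Σ_{P∩Q} c`).  The RECURSIVE CERTIFICATE of `U` (seat memos gen 22 §3/§10, gen 23) is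
  `d(x) = d_pair(x) + (1 − 1_X(x))·N(freeOf x)·(c(cellOf x) − 2^k·1_V(cellOf x))`,   `N(ξ) = 2^n − ν_{X_I}(ξ)`,
`d_pair` the pair certificate of `X ∪ Y` (`X` pays, `…PairCert`).  For `n = 1`, `X_I = {2}` this is the literal-absorption certificate of
`…LiteralTwoAbsorb` (there `N ≡ 1` on `{0,1}`).  THIS FILE PROVES, for every `n, k`:
* `orthantAbsorb_cert_nonneg`: `d ≥ 0` whenever `c ≥ 0`;
* `orthantAbsorb_core_sum_eq`: `Σ_{x∈S} (1 − 1_X)N(freeOf x)(c − 2^k 1_V)(cellOf x) = Σ_ξ (1 − 1_{X_I}(ξ)) N(ξ) Σ_q 1_{S_ξ}(q)(c(q) − 2^k 1_V(q))`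
  (the correction is a sum of `e := c − 2^k 1_V` over the SECTIONS `S_ξ`, weighted by `N(ξ)` over the free points outside `X_I`);
* `orthantAbsorb_cert_T`: condition (T) `Σ_W d ≤ Σ_W λ_U` for every up-set `W`, from (T') for `c` at the sections `W_ξ` (`ξ ∉ X_I`) and the
  fibrewise Harris slacks of `pairCert_slack_eq` — the slack is `2^k Σ_{q∉V} H_n(X_I;W^q) + Σ_{ξ∉X_I} N(ξ)·[(T')-slack of c at W_ξ]`;
* `orthantAbsorb_N_of_core`: condition (N) for `d` FOLLOWS from the single CORE INEQUALITY
    `Φ_pair(A∩A') ≤ sStarD (X∪Y) A A' + Σ_{ξ∉X_I} N(ξ)·e(A_ξ ∩ A'_ξ)`   (all up-sets `A, A'`; `Φ_pair` the closed-form slack of `pairCert_slack_eq`),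
  i.e. `F^X_V(A,A') + ⟨e, κ_{A,A'}⟩ ≥ 0` with `κ = Σ_{ξ∉X_I} N(ξ)·1_{A_ξ∩A'_ξ}` in the notation of the gen-23 memo;
* `sStarD_cylSet_orthantAbsorb_nonneg_of_core`: hence, given the core inequality and `c ≥ 0`, (T'), `U × [3]^m` is a good first slot of
  the pattern functional in every dimension (`sStarD_cylSet_nonneg_of_diagCert`).
The core inequality is CONJECTURE O of the seat memos (numerically flawless; gen 23 reduces it further to (N') on section pairs with
adaptive multiplicities, 'LP-α').  It is PROVED in the tree for `n = 1` (`…LiteralTwoAbsorbCore`, `…TwoOrthantLiteral`) and for `V` an orthant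
with its trivial vector (`…TwoOrthant`); nothing in this file asserts it in general, nor `PatternPos d` for `d ≥ 4`. [this work]
-/

namespace Summit.CriticalPhenomena.PercolationContinuityZ3.Theorems.SahiGridPattern

open Finset SahiGrid3
open scoped BigOperators

variable {n k : ℕ}

/-! ### The correction term as a weighted sum over sections -/

/-- **The correction of the recursive certificate, summed over a finset, is an `N`-weighted sum of `e = c − 2^k 1_V` over its sections.** [this work] -/
theorem orthantAbsorb_core_sum_eq {X : Finset (Pd (n + k))} {XI : Finset (Pd n)} (hX : ∀ ξ q, glue ξ q ∈ X ↔ ξ ∈ XI)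
    (V : Finset (Pd k)) (c : Pd k → ℤ) (S : Finset (Pd (n + k))) :
    (∑ x ∈ S, (1 - ind X x) * ((2:ℤ) ^ n - (nuCount XI (freeOf x) : ℤ)) * (c (cellOf x) - 2 ^ k * ind V (cellOf x)))
      = ∑ ξ : Pd n, (1 - ind XI ξ) * ((2:ℤ) ^ n - (nuCount XI ξ : ℤ)) * ∑ q : Pd k, ind (sect S ξ) q * (c q - 2 ^ k * ind V q) := by
  rw [sum_mem_eq_sum_ind_mul, sum_glue]
  refine Finset.sum_congr rfl fun ξ _ => ?_
  rw [Finset.mul_sum]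
  refine Finset.sum_congr rfl fun q _ => ?_
  rw [ind_sect, ind_glue_of_free hX, freeOf_glue, cellOf_glue]
  ring

/-! ### Nonnegativity and condition (T) -/

/-- **The recursive certificate is nonnegative** (`c ≥ 0` suffices): on `X` it is the pair certificate, off `X` it equals
`N(ξ)·c(q) + ν_{X_I}(ξ)·2^k·1_V(q) ≥ 0`. [this work] -/
theorem orthantAbsorb_cert_nonneg {X Y : Finset (Pd (n + k))} (XI : Finset (Pd n)) {V : Finset (Pd k)}
    (hY : ∀ ξ q, glue ξ q ∈ Y ↔ q ∈ V) (c : Pd k → ℤ) (hc : ∀ q, 0 ≤ c q) (x : Pd (n + k)) :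
    0 ≤ (2:ℤ) ^ (n + k) * (ind X x + ind Y x) - ind X x * ((nuCount (X ∪ Y) x : ℤ) - nuCount X x)
        - ind X x * ind Y x * (nuCount X x : ℤ)
        + (1 - ind X x) * ((2:ℤ) ^ n - (nuCount XI (freeOf x) : ℤ)) * (c (cellOf x) - 2 ^ k * ind V (cellOf x)) := by
  have h3 := pairCert_nonneg X Y x
  by_cases hx : x ∈ X
  · have e : ind X x = 1 := by unfold ind; rw [if_pos hx]
    rw [e] at h3 ⊢
    nlinarith [h3]
  · have e : ind X x = 0 := by unfold ind; rw [if_neg hx]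
    have eY : ind Y x = ind V (cellOf x) := by
      have hm : x ∈ Y ↔ cellOf x ∈ V := by
        have := hY (freeOf x) (cellOf x); rwa [glue_freeOf_cellOf] at this
      unfold ind
      by_cases hy : x ∈ Y
      · rw [if_pos hy, if_pos (hm.1 hy)]
      · rw [if_neg hy, if_neg (fun h => hy (hm.2 h))]
    rw [e, eY]
    have h2 := hc (cellOf x)
    have hU := ind_nonneg' V (cellOf x)
    have hU1 := ind_le_one' V (cellOf x)
    have hν := nuCount_le_two_pow XI (freeOf x)
    have hν0 := nuCount_cast_nonneg XI (freeOf x)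
    have hp : (2:ℤ) ^ (n + k) = 2 ^ n * 2 ^ k := by rw [pow_add]
    have hk : (0:ℤ) ≤ 2 ^ k := pow_nonneg (by norm_num) k
    rw [hp]
    -- value = ν·2^k·1_V + (2^n − ν)·c
    have hval : 2 ^ n * (2:ℤ) ^ k * (0 + ind V (cellOf x)) - 0 * ((nuCount (X ∪ Y) x : ℤ) - nuCount X x) - 0 * ind V (cellOf x) * (nuCount X x : ℤ)
        + (1 - 0) * ((2:ℤ) ^ n - (nuCount XI (freeOf x) : ℤ)) * (c (cellOf x) - 2 ^ k * ind V (cellOf x))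
        = (nuCount XI (freeOf x) : ℤ) * (2 ^ k * ind V (cellOf x)) + ((2:ℤ) ^ n - (nuCount XI (freeOf x) : ℤ)) * c (cellOf x) := by ring
    rw [hval]
    have t1 : 0 ≤ (nuCount XI (freeOf x) : ℤ) * (2 ^ k * ind V (cellOf x)) := mul_nonneg hν0 (mul_nonneg hk hU)
    have t2 : 0 ≤ ((2:ℤ) ^ n - (nuCount XI (freeOf x) : ℤ)) * c (cellOf x) := mul_nonneg (by linarith) h2
    linarith

/-- **CONDITION (T) FOR THE RECURSIVE CERTIFICATE, every `n, k`**: if `X_I`, `V` are up-sets and `c` satisfies (T') for `V`, then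
`Σ_{x∈W} d(x) ≤ Σ_{x∈W} λ_{X∪Y}(x)` for every up-set `W ⊆ [3]^{n+k}`.  The slack is
`2^k Σ_q (1 − 1_V(q))·H_n(X_I; W^q) + Σ_ξ (1 − 1_{X_I}(ξ)) N(ξ)·Σ_{q ∈ W_ξ} (λ_V(q) − c(q))` — fibrewise Harris plus sectionwise (T'). [this work] -/
theorem orthantAbsorb_cert_T {X Y : Finset (Pd (n + k))} {XI : Finset (Pd n)} {V : Finset (Pd k)}
    (hX : ∀ ξ q, glue ξ q ∈ X ↔ ξ ∈ XI) (hY : ∀ ξ q, glue ξ q ∈ Y ↔ q ∈ V)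
    (hXI : IsUpperSet (XI : Set (Pd n))) (c : Pd k → ℤ)
    (hT' : ∀ P : Finset (Pd k), IsUpperSet (P : Set (Pd k)) → (∑ q ∈ P, c q) ≤ ∑ q ∈ P, lamU V q)
    (W : Finset (Pd (n + k))) (hW : IsUpperSet (W : Set (Pd (n + k)))) :
    (∑ x ∈ W, ((2:ℤ) ^ (n + k) * (ind X x + ind Y x) - ind X x * ((nuCount (X ∪ Y) x : ℤ) - nuCount X x)
        - ind X x * ind Y x * (nuCount X x : ℤ)
        + (1 - ind X x) * ((2:ℤ) ^ n - (nuCount XI (freeOf x) : ℤ)) * (c (cellOf x) - 2 ^ k * ind V (cellOf x))))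
      ≤ ∑ x ∈ W, lamU (X ∪ Y) x := by
  have eΦ := pairCert_slack_eq hX hY W
  rw [Finset.sum_sub_distrib] at eΦ
  rw [Finset.sum_add_distrib, orthantAbsorb_core_sum_eq hX V c W]
  -- the fibrewise Harris family is nonnegative
  have HA : ∀ q : Pd k, 0 ≤ ∑ ξ : Pd n, ind (fibre W q) ξ * (2 ^ n * ind XI ξ - (nuCount XI ξ : ℤ)) :=
    fun q => sum_ind_mul_harrisSlack_nonneg XI (fibre W q) hXI (isUpperSet_fibre hW q)
  have hA : 0 ≤ 2 ^ k * (∑ q : Pd k, (1 - ind V q) * ∑ ξ : Pd n, ind (fibre W q) ξ * (2 ^ n * ind XI ξ - (nuCount XI ξ : ℤ))) :=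
    mul_nonneg (pow_nonneg (by norm_num) k) (Finset.sum_nonneg fun q _ =>
      mul_nonneg (by linarith [ind_le_one' V q]) (HA q))
  -- sectionwise: (T') for `c` at `W_ξ` bounds the correction by the second family
  have hsec : ∀ ξ : Pd n, (∑ q : Pd k, ind (sect W ξ) q * (c q - 2 ^ k * ind V q))
      ≤ ∑ q : Pd k, ind (sect W ξ) q * (2 ^ k * ind V q - (nuCount V q : ℤ)) := by
    intro ξ
    have hT := hT' (sect W ξ) (isUpperSet_sect hW ξ)
    rw [sum_mem_eq_sum_ind_mul (sect W ξ), sum_mem_eq_sum_ind_mul (sect W ξ)] at hT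
    have e1 : (∑ q : Pd k, ind (sect W ξ) q * (2 ^ k * ind V q - (nuCount V q : ℤ)))
        - (∑ q : Pd k, ind (sect W ξ) q * (c q - 2 ^ k * ind V q))
        = (∑ q : Pd k, ind (sect W ξ) q * lamU V q) - ∑ q : Pd k, ind (sect W ξ) q * c q := by
      rw [← Finset.sum_sub_distrib, ← Finset.sum_sub_distrib]
      refine Finset.sum_congr rfl fun q _ => ?_
      unfold lamU; ring
    linarith
  have hB : (∑ ξ : Pd n, (1 - ind XI ξ) * ((2:ℤ) ^ n - (nuCount XI ξ : ℤ)) * ∑ q : Pd k, ind (sect W ξ) q * (c q - 2 ^ k * ind V q))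
      ≤ ∑ ξ : Pd n, (1 - ind XI ξ) * (2 ^ n - (nuCount XI ξ : ℤ)) * ∑ q : Pd k, ind (sect W ξ) q * (2 ^ k * ind V q - (nuCount V q : ℤ)) := by
    refine Finset.sum_le_sum fun ξ _ => ?_
    exact mul_le_mul_of_nonneg_left (hsec ξ)
      (mul_nonneg (by linarith [ind_le_one' XI ξ]) (by linarith [nuCount_le_two_pow XI ξ]))
  linarith

/-! ### Condition (N): reduction to the core inequality -/

/-- **CONDITION (N) FROM THE CORE INEQUALITY** (every `n, k`): if for all up-sets `A, A'`
`Φ_pair(A∩A') ≤ sStarD (X∪Y) A A' + Σ_ξ (1 − 1_{X_I}(ξ)) N(ξ) Σ_{q ∈ (A∩A')_ξ} (c(q) − 2^k 1_V(q))`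
(`Φ_pair` the closed-form slack of `pairCert_slack_eq`), then the recursive certificate satisfies condition (N) of `…DiagCert`.
The hypothesis is Conjecture O of the seat memos ("`F^X_V(A,A') + ⟨e, κ_{A,A'}⟩ ≥ 0`"); it is not asserted here. [this work] -/
theorem orthantAbsorb_N_of_core {X Y : Finset (Pd (n + k))} {XI : Finset (Pd n)} {V : Finset (Pd k)}
    (hX : ∀ ξ q, glue ξ q ∈ X ↔ ξ ∈ XI) (hY : ∀ ξ q, glue ξ q ∈ Y ↔ q ∈ V) (c : Pd k → ℤ)
    (hcore : ∀ A A' : Finset (Pd (n + k)), IsUpperSet (A : Set (Pd (n + k))) → IsUpperSet (A' : Set (Pd (n + k))) →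
      2 ^ k * (∑ q : Pd k, (1 - ind V q) * ∑ ξ : Pd n, ind (fibre (A ∩ A') q) ξ * (2 ^ n * ind XI ξ - (nuCount XI ξ : ℤ)))
        + (∑ ξ : Pd n, (1 - ind XI ξ) * (2 ^ n - (nuCount XI ξ : ℤ)) * ∑ q : Pd k, ind (sect (A ∩ A') ξ) q * (2 ^ k * ind V q - (nuCount V q : ℤ)))
        ≤ sStarD (X ∪ Y) A A'
          + ∑ ξ : Pd n, (1 - ind XI ξ) * ((2:ℤ) ^ n - (nuCount XI ξ : ℤ)) * ∑ q : Pd k, ind (sect (A ∩ A') ξ) q * (c q - 2 ^ k * ind V q)) :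
    ∀ A A' : Finset (Pd (n + k)), IsUpperSet (A : Set (Pd (n + k))) → IsUpperSet (A' : Set (Pd (n + k))) →
      (∑ q ∈ A, ∑ r ∈ A', thetaVal (X ∪ Y) q r) ≤
        ∑ x ∈ A ∩ A', ((2:ℤ) ^ (n + k) * (ind X x + ind Y x) - ind X x * ((nuCount (X ∪ Y) x : ℤ) - nuCount X x)
          - ind X x * ind Y x * (nuCount X x : ℤ)
          + (1 - ind X x) * ((2:ℤ) ^ n - (nuCount XI (freeOf x) : ℤ)) * (c (cellOf x) - 2 ^ k * ind V (cellOf x))) := by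
  intro A A' hA hA'
  have h1 := sStarD_eq_sum_lamU_sub_sum_thetaVal (X ∪ Y) A A'
  have h2 := pairCert_slack_eq hX hY (A ∩ A')
  have h3 := hcore A A' hA hA'
  have h4 := orthantAbsorb_core_sum_eq hX V c (A ∩ A')
  rw [Finset.sum_sub_distrib] at h2
  rw [Finset.sum_add_distrib, h4]
  linarith

/-- **THE RECURSIVE CERTIFICATE IS A DIAGONAL CERTIFICATE, GIVEN THE CORE INEQUALITY** (every `n, k`): with `X_I` an up-set, `c ≥ 0`
satisfying (T') for `V`, and the core inequality of `orthantAbsorb_N_of_core`, the vector `d` is nonnegative and satisfies (T) and (N) for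
`U = X ∪ Y`. [this work] -/
theorem orthantAbsorb_cert_of_core {X Y : Finset (Pd (n + k))} {XI : Finset (Pd n)} {V : Finset (Pd k)}
    (hX : ∀ ξ q, glue ξ q ∈ X ↔ ξ ∈ XI) (hY : ∀ ξ q, glue ξ q ∈ Y ↔ q ∈ V)
    (hXI : IsUpperSet (XI : Set (Pd n))) (c : Pd k → ℤ) (hc : ∀ q, 0 ≤ c q)
    (hT' : ∀ P : Finset (Pd k), IsUpperSet (P : Set (Pd k)) → (∑ q ∈ P, c q) ≤ ∑ q ∈ P, lamU V q)
    (hcore : ∀ A A' : Finset (Pd (n + k)), IsUpperSet (A : Set (Pd (n + k))) → IsUpperSet (A' : Set (Pd (n + k))) →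
      2 ^ k * (∑ q : Pd k, (1 - ind V q) * ∑ ξ : Pd n, ind (fibre (A ∩ A') q) ξ * (2 ^ n * ind XI ξ - (nuCount XI ξ : ℤ)))
        + (∑ ξ : Pd n, (1 - ind XI ξ) * (2 ^ n - (nuCount XI ξ : ℤ)) * ∑ q : Pd k, ind (sect (A ∩ A') ξ) q * (2 ^ k * ind V q - (nuCount V q : ℤ)))
        ≤ sStarD (X ∪ Y) A A'
          + ∑ ξ : Pd n, (1 - ind XI ξ) * ((2:ℤ) ^ n - (nuCount XI ξ : ℤ)) * ∑ q : Pd k, ind (sect (A ∩ A') ξ) q * (c q - 2 ^ k * ind V q)) :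
    (∀ x : Pd (n + k), 0 ≤ (2:ℤ) ^ (n + k) * (ind X x + ind Y x) - ind X x * ((nuCount (X ∪ Y) x : ℤ) - nuCount X x)
        - ind X x * ind Y x * (nuCount X x : ℤ)
        + (1 - ind X x) * ((2:ℤ) ^ n - (nuCount XI (freeOf x) : ℤ)) * (c (cellOf x) - 2 ^ k * ind V (cellOf x))) ∧
    (∀ W : Finset (Pd (n + k)), IsUpperSet (W : Set (Pd (n + k))) →
      (∑ x ∈ W, ((2:ℤ) ^ (n + k) * (ind X x + ind Y x) - ind X x * ((nuCount (X ∪ Y) x : ℤ) - nuCount X x)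
        - ind X x * ind Y x * (nuCount X x : ℤ)
        + (1 - ind X x) * ((2:ℤ) ^ n - (nuCount XI (freeOf x) : ℤ)) * (c (cellOf x) - 2 ^ k * ind V (cellOf x))))
      ≤ ∑ x ∈ W, lamU (X ∪ Y) x) ∧
    (∀ A A' : Finset (Pd (n + k)), IsUpperSet (A : Set (Pd (n + k))) → IsUpperSet (A' : Set (Pd (n + k))) →
      (∑ q ∈ A, ∑ r ∈ A', thetaVal (X ∪ Y) q r) ≤
        ∑ x ∈ A ∩ A', ((2:ℤ) ^ (n + k) * (ind X x + ind Y x) - ind X x * ((nuCount (X ∪ Y) x : ℤ) - nuCount X x)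
          - ind X x * ind Y x * (nuCount X x : ℤ)
          + (1 - ind X x) * ((2:ℤ) ^ n - (nuCount XI (freeOf x) : ℤ)) * (c (cellOf x) - 2 ^ k * ind V (cellOf x)))) :=
  ⟨fun x => orthantAbsorb_cert_nonneg XI hY c hc x, fun W hW => orthantAbsorb_cert_T hX hY hXI c hT' W hW,
    orthantAbsorb_N_of_core hX hY c hcore⟩

/-- **EVERY-DIMENSION GOODNESS OF `X ∪ Y` FROM THE CORE INEQUALITY**: under the hypotheses of `orthantAbsorb_cert_of_core`,
`(X ∪ Y) × [3]^m` is a good first slot of the pattern functional for every `m` (`sStarD_cylSet_nonneg_of_diagCert`). [this work] -/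
theorem sStarD_cylSet_orthantAbsorb_nonneg_of_core {m : ℕ} {X Y : Finset (Pd (n + k))} {XI : Finset (Pd n)} {V : Finset (Pd k)}
    (hX : ∀ ξ q, glue ξ q ∈ X ↔ ξ ∈ XI) (hY : ∀ ξ q, glue ξ q ∈ Y ↔ q ∈ V)
    (hXI : IsUpperSet (XI : Set (Pd n))) (c : Pd k → ℤ) (hc : ∀ q, 0 ≤ c q)
    (hT' : ∀ P : Finset (Pd k), IsUpperSet (P : Set (Pd k)) → (∑ q ∈ P, c q) ≤ ∑ q ∈ P, lamU V q)
    (hcore : ∀ A A' : Finset (Pd (n + k)), IsUpperSet (A : Set (Pd (n + k))) → IsUpperSet (A' : Set (Pd (n + k))) →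
      2 ^ k * (∑ q : Pd k, (1 - ind V q) * ∑ ξ : Pd n, ind (fibre (A ∩ A') q) ξ * (2 ^ n * ind XI ξ - (nuCount XI ξ : ℤ)))
        + (∑ ξ : Pd n, (1 - ind XI ξ) * (2 ^ n - (nuCount XI ξ : ℤ)) * ∑ q : Pd k, ind (sect (A ∩ A') ξ) q * (2 ^ k * ind V q - (nuCount V q : ℤ)))
        ≤ sStarD (X ∪ Y) A A'
          + ∑ ξ : Pd n, (1 - ind XI ξ) * ((2:ℤ) ^ n - (nuCount XI ξ : ℤ)) * ∑ q : Pd k, ind (sect (A ∩ A') ξ) q * (c q - 2 ^ k * ind V q))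
    {B C : Finset (Pd (m + (n + k)))} (hB : IsUpperSet (B : Set (Pd (m + (n + k))))) (hC : IsUpperSet (C : Set (Pd (m + (n + k))))) :
    0 ≤ sStarD (cylSet (X ∪ Y) : Finset (Pd (m + (n + k)))) B C := by
  obtain ⟨h0, hT, hN⟩ := orthantAbsorb_cert_of_core hX hY hXI c hc hT' hcore
  exact sStarD_cylSet_nonneg_of_diagCert (X ∪ Y) _ h0 hT hN hB hC

end Summit.CriticalPhenomena.PercolationContinuityZ3.Theorems.SahiGridPattern
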